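import Mathlib

/-!
# Crux `ExactCertificate` (stmt-AtomisticToContinuum-11959), line `closure-makes-nogap-exact`,
# Transfer skeleton VI (`UniquePeriodicMinimiser1D`): stub `stub_isometryChain1D`

Support file for the crux `ThreeConeCertificate.ExactCertificate`, d = 1 transfer skeleton VI
(`Cruxes.ExactCertificate.Transfer1D.UniquePeriodicMinimiser1D`).  This file proves the registered
stub `stub_isometryChain1D`: ISOMETRIC IMAGES OF A CHAIN ARE TRANSLATED CHAINS.  For the zero-pressure
chain `aℤe₀ = {(k a) e₀ : k ∈ ℤ}` of the line `E¹ = EuclideanSpace ℝ (Fin 1)` (`e₀ = single 0 1`),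
any `q : E¹` and any linear isometry `A` of `E¹`,

  `q + A(aℤe₀) = q + aℤe₀` as point sets.

Proof: (1) every vector of `E¹` is its `0`-th coordinate times `e₀` (`uiso_eq_smul_single`), so by
linearity `A (single 0 t) = single 0 (s t)` with `s = (A e₀) 0` (`uiso_map_single`), and
`|s| = ‖A e₀‖ = ‖e₀‖ = 1`, i.e. `s = ±1` (`uiso_linearIsometry_single`); (2) for `s = 1` the two
ranges agree termwise, for `s = -1` reindex `k ↦ -k`.

All `[folklore]` (linear algebra of the line); no named facts are used; `import Mathlib` only.
-/

noncomputable section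

namespace Summit.AtomisticToContinuum.Crystallization.Theorems.ThreeConeCertificateExactCertificate.Transfer1D

open MeasureTheory Set Filter Topology
open scoped BigOperators

/-- Every vector of the line `E¹` is its `0`-th coordinate times `e₀ = single 0 1`. [folklore] -/
theorem uiso_eq_smul_single (v : EuclideanSpace ℝ (Fin 1)) :
    v = (v 0) • EuclideanSpace.single (0 : Fin 1) (1 : ℝ) := by
  ext i
  have hi : i = 0 := Fin.eq_zero i
  subst hi
  simp only [PiLp.smul_apply, PiLp.single_apply, if_true, smul_eq_mul, mul_one]

/-- A linear isometry (indeed any linear map) of the line acts on `single 0 t` as multiplication by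
the `0`-th coordinate `s = (A e₀) 0` of the image of `e₀`: `A (single 0 t) = single 0 (s t)`.
[folklore] -/
theorem uiso_map_single (A : EuclideanSpace ℝ (Fin 1) →ₗᵢ[ℝ] EuclideanSpace ℝ (Fin 1)) (t : ℝ) :
    A (EuclideanSpace.single (0 : Fin 1) t) =
      EuclideanSpace.single (0 : Fin 1) ((A (EuclideanSpace.single (0 : Fin 1) (1 : ℝ))) 0 * t) := by
  have h1 : EuclideanSpace.single (0 : Fin 1) t = t • EuclideanSpace.single (0 : Fin 1) (1 : ℝ) := by
    rw [uiso_eq_smul_single (EuclideanSpace.single (0 : Fin 1) t), PiLp.single_apply, if_pos rfl]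
  rw [h1, LinearIsometry.map_smul]
  ext i
  have hi : i = 0 := Fin.eq_zero i
  subst hi
  simp only [PiLp.smul_apply, PiLp.single_apply, if_true, smul_eq_mul, mul_comm]

/-- The linear isometries of the line are `±1` on the axis: either `A (single 0 t) = single 0 t`
for all `t`, or `A (single 0 t) = single 0 (-t)` for all `t`. [folklore] -/
theorem uiso_linearIsometry_single
    (A : EuclideanSpace ℝ (Fin 1) →ₗᵢ[ℝ] EuclideanSpace ℝ (Fin 1)) :
    (∀ t : ℝ, A (EuclideanSpace.single (0 : Fin 1) t) = EuclideanSpace.single (0 : Fin 1) t) ∨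
    (∀ t : ℝ, A (EuclideanSpace.single (0 : Fin 1) t) = EuclideanSpace.single (0 : Fin 1) (-t)) := by
  set s : ℝ := (A (EuclideanSpace.single (0 : Fin 1) (1 : ℝ))) 0 with hs
  have habs : |s| = 1 := by
    have h1 : ‖A (EuclideanSpace.single (0 : Fin 1) (1 : ℝ))‖ = 1 := by
      rw [LinearIsometry.norm_map, EuclideanSpace.single, PiLp.norm_single, norm_one]
    rw [uiso_eq_smul_single (A (EuclideanSpace.single (0 : Fin 1) (1 : ℝ))), norm_smul,
      EuclideanSpace.single, PiLp.norm_single, norm_one, mul_one, Real.norm_eq_abs] at h1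
    exact h1
  rcases (abs_eq (zero_le_one : (0 : ℝ) ≤ 1)).1 habs with h | h
  · refine Or.inl fun t => ?_
    rw [uiso_map_single A t, ← hs, h, one_mul]
  · refine Or.inr fun t => ?_
    rw [uiso_map_single A t, ← hs, h, neg_one_mul]

/-- STUB W5 `stub_isometryChain1D` — ISOMETRIC IMAGES OF A CHAIN ARE TRANSLATED CHAINS: for a linear
isometry `A` of the line (`A = ±1`) and any `q`, `q + A(aℤe₀) = q + aℤe₀` as point sets (reindex
`k ↦ −k`). [folklore] -/
theorem stub_isometryChain1D : ∀ (a : ℝ) (q : EuclideanSpace ℝ (Fin 1))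
    (A : EuclideanSpace ℝ (Fin 1) →ₗᵢ[ℝ] EuclideanSpace ℝ (Fin 1)),
    (fun p => q + A p) '' Set.range (fun k : ℤ => EuclideanSpace.single (0 : Fin 1) ((k : ℝ) * a)) =
      Set.range (fun k : ℤ => q + EuclideanSpace.single (0 : Fin 1) ((k : ℝ) * a)) := by
  intro a q A
  rw [← Set.range_comp]
  rcases uiso_linearIsometry_single A with h | h
  · refine congrArg Set.range (funext fun k => ?_)
    simp only [Function.comp_apply, h]
  · have hfun : ((fun p => q + A p) ∘ fun k : ℤ => EuclideanSpace.single (0 : Fin 1) ((k : ℝ) * a)) =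
        (fun k : ℤ => q + EuclideanSpace.single (0 : Fin 1) ((k : ℝ) * a)) ∘ (fun k : ℤ => -k) := by
      funext k
      simp only [Function.comp_apply, h, Int.cast_neg, neg_mul]
    rw [hfun, neg_surjective.range_comp]

end Summit.AtomisticToContinuum.Crystallization.Theorems.ThreeConeCertificateExactCertificate.Transfer1D
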